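import Literature.MathematicalPhysics.QuantumFieldTheory.Federbush1986.ModeAnalyticityThm31Refutation

/-!
# Federbush–Williamson, *A phase cell approach to Yang–Mills theory. II. Analysis of a mode* (J. Math. Phys. **28** (1987)
# 1416–1419), Theorem 3.1 at `p = 0`: the light-cone pole of the printed mode is a GAUGE ARTEFACT

statement-level skeleton of published theorems with citation tags; proofs where landed; nothing here is a claim about the Yang–Mills mass gap

Cell `lit-balaban`, Phase-2 proof seat **p04** (gen 6), continuing the seat's gen-5 lane (row `F2.Thm3.1`, owner r17,
referee ref-5; fold-owner flag of 2026-08-21T05:40Z: «F1.Eq3.13-3.15 … FLAGGED, NOT refuted … status open»).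
Source: P. Federbush, C. Williamson, J. Math. Phys. **28** (1987) 1416–1419 [bib `FederbushWilliamson1987PhaseCellII`],
Theorem 3.1 (3.2) p. 1417, the gauge transformation (2.4)–(2.5) p. 1417 («We define `A^N_i(p)`, a gauge transformation of
`A′_i(p)`, by `A^N_i(p) = A′_i(p) + p_iX(p)` (2.4)»; I p. 328: the choice is «far from unique»), and the algebra of §V
p. 1417–1418: (5.3) `p_j²⟨1/p_j²⟩ = r₀e_j/p²`, (5.5), (5.7) `e_j = 1 + δ_j`, (5.8) «By an algebraic miracle the terms in `a₁`
of zero degree of homogeneity exactly cancel» (renders `run/shared/lean/pub/pub-balaban/t4/b2b-balaban-t4-lit2/g7/fw1987II/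
fedwill1987-jmp28-II-p002-x2.png`, `-p003-x2.png`, re-read by this seat).

WHAT THE TREE ALREADY HAS (this seat, gen 5).  `ModeAnalyticityThm31Refutation.not_theorem31 (s) : ¬ Theorem31 s 0`
(p250244): for EVERY printed gauge function `X` of (2.5) (every `s`) the component `A^N_1` of the typed mode has a pole
along the complex light cone `{p² = 0}` through `p = 0`, so no function holomorphic near `0` agrees with it at the real
generic momenta (`no_holomorphic_extension`).  The pole sits in the factor `1/p²` of (2.1)/(2.5); by (5.3)/(5.5) the typed
mode is, at the generic points of the ball `‖p‖ < ½` (`U`),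
  `A^N_1 = Φ/(p²r₀) · [N/(1+ĝ) + p₁²/(e₁(1+p²)^s)]`,  `A^N_i = Φp₁p_i/(p²r₀) · [−e_ae_b/(1+ĝ) + 1/(e₁(1+p²)^s)]` (`i ≠ 1`,
`{a,b} = {2,3,4}∖{i}`), with `Φ, r₀, e_j = 1 + p²D_j, N, ĝ` holomorphic on `U` and `r₀, e_j, 1+ĝ ≠ 0` there
(`ModeAnalyticityBracketSplit`, `ModeAnalyticityLatticeSums`).

WHAT THIS FILE PROVES (kernel-checked; axioms `propext`/`Classical.choice`/`Quot.sound`).  Print's indices `1…4` are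
Lean's `0…3`.
* §1 `Xtilde` — the MODIFIED GAUGE FUNCTION `X̃(p) := −r_L f̄₁⁻¹ · (16/𝒟) · r₀⁻¹ · ⟨1/p₂²⟩⟨1/p₃²⟩⟨1/p₄²⟩`, written in the
  paper's own vocabulary ((1.4) brackets, (1.7) `r_L`, (1.18) `𝒟`, (5.4) `r₀`); it is NOT of the printed form (2.5).
  `ANtilde i = A′_i + p_i·X̃` — the mode (2.1) in the gauge `X̃` ((2.4) with `X̃` for `X`).  `Xtilde_eq`: on the generic points
  of `U`, `X̃ = Φp₁e₂e₃e₄/(p²r₀(1+ĝ))`.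
* §2 the holomorphic representatives `gRep i` (`gRep 0 = ΦQ̃/(r₀(1+ĝ))` with `N + p₁²e₂e₃e₄ = p²·Q̃` — `Nn_add_eq`, the
  all-orders form of the «algebraic miracle» (5.8): the numerator vanishes on the WHOLE complex cone, not only to second
  order; `gRep i = p_ip₁Φ·(∏_{j≠1,i}e_j)·D_i/(r₀(1+ĝ))` for `i ≠ 1`) and `analyticOnNhd_gRep : AnalyticOnNhd ℂ (gRep i) U`.
* §3 THE IDENTITIES `ANtilde_eq_gRep`: at every `p ∈ U` with all `p_j ≠ 0`, `p² ≠ 0`, `e^{ip₁} ≠ 1` (in particular at every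
  real generic momentum of `U`, `realGeneric_conds`), `A′_i + p_iX̃ = gRep i` for ALL FOUR `i` — from (5.3)
  (`invSqBracket_eq`), (1.18) (`scrD_eq`), (2.2)–(2.3) (`l_zero`…`l_three`), (5.1) (`prefactor_eq`).
* §4 **`theorem31_at_zero_in_gauge_Xtilde (i)`**: `∃ g` holomorphic on the ball `‖p‖ < ½` with `g = A′_i + p_iX̃` at the
  real generic momenta of the ball — the CONCLUSION OF THEOREM 3.1 HOLDS NEAR `p = 0` IN THE GAUGE `X̃`, for every
  component; together with `not_theorem31` this is `gauge_artefact (s)`: in every printed gauge (2.5) it fails (`i = 1`),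
  in the gauge `X̃` it holds (all `i`).  (The ball `‖p‖ < ½` is a neighbourhood of `0` inside `𝒟_L(ε₀)` for `ε₀ ≥ ½` and
  contains `𝒟_L(ε₀) ∩ {‖p‖ < ½}` always; nothing is claimed away from `p = 0`.)
* §5 **`fieldStrength_analytic (s i j)`**: the gauge-invariant content of the PRINTED mode — the momentum-space field
  strength `p_iA^N_j − p_jA^N_i` (`= p_iA′_j − p_jA′_i`, independent of `X`, `fieldStrength_eq_prime`) — extends
  holomorphically to `‖p‖ < ½` for every `s` and all `i, j`: the light-cone pole of p250244 is pure gauge.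

HONEST SCOPE.  (a) This is OUR repair of the gauge choice (2.5), proved; print's Theorem 3.1 as typed stays refuted
(p250244).  (b) Local at `p = 0` only: analyticity of `A′ + pX̃` on the rest of `𝒟_L` (near the real cube away from `0`, and
the non-vanishing of `𝒟`, `f̄₁`, `⟨1/p₁²⟩`, `1+ĝ` there) is not addressed, nor the growth bound (3.5) (`X̃` lacks the
`(1+p²)^{−s}` damping of (2.5) — immaterial on the bounded `𝒟_L`, relevant for Theorem 3.3 on `𝒟_B`).  (c) Whether I
(3.13)–(3.15) (F1.Eq3.13-3.15, owner r17) follow for the mode in the gauge `X̃` «by standard techniques» (§IV) is NOT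
decided here; what §5 shows is that no gauge-INVARIANT obstruction exists at `p = 0`.
Value = kernel theorems locating the F2 defect in the gauge choice (2.5) and removing it at `p = 0`; NOT summit progress.
-/

namespace Literature.MathematicalPhysics.QuantumFieldTheory.Federbush1986

noncomputable section

namespace ModeAnalyticityGaugeRepair

open ModeAnalyticity ModeAnalyticityLatticeSums ModeAnalyticityBracketSplit ModeAnalyticityThm31Refutation
  Complex Filter Topology Finset Metric Set
open scoped BigOperators Real

/-! ## §1. The modified gauge function `X̃` and the mode in the gauge `X̃` -/

/-- **The modified gauge function** `X̃(p) := (−r_L f̄₁⁻¹)·(16/𝒟)·r₀⁻¹·⟨1/p₂²⟩⟨1/p₃²⟩⟨1/p₄²⟩` (print's indices; Lean's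
brackets `1, 2, 3`), in the vocabulary of (1.4), (1.7), (1.18), (5.4).  It replaces the printed `X(p)` of (2.5) in the gauge
transformation (2.4); it is NOT of the form (2.5) for any `s`. [cite: FederbushWilliamson1987PhaseCellII, (2.4)–(2.5)
p. 1417; (5.4) p. 1418] -/
def Xtilde (p : Momentum) : ℂ :=
  (-rL p * (fbar p 0)⁻¹) * (16 / scrD p) * (invSqBracket 1 p * invSqBracket 2 p * invSqBracket 3 p) / r0 p

/-- **The mode in the gauge `X̃`**: `Ã^N_i(p) := A′_i(p) + p_i X̃(p)` — (2.4) with `X̃` in place of `X` («a gauge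
transformation of `A′_i(p)`»). [cite: FederbushWilliamson1987PhaseCellII, (2.1), (2.4) p. 1417] -/
def ANtilde (i : Fin 4) (p : Momentum) : ℂ := Aprime i p + p i * Xtilde p

/-! ## §2. The holomorphic representatives -/

/-- `Q̃` — the quotient `(N + p₁²e₂e₃e₄)/p²` written out as a polynomial in `p_j²`, `p²`, `D_j` (`e_j = 1 + p²D_j`):
the all-orders content of the «algebraic miracle» (5.8). [cite: FederbushWilliamson1987PhaseCellII, (5.5)–(5.8) p. 1418] -/
def Qr (p : Momentum) : ℂ :=
  1 + ((p 3) ^ 2 * (D 1 p + D 2 p) + (p 2) ^ 2 * (D 1 p + D 3 p) + (p 1) ^ 2 * (D 2 p + D 3 p)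
        + (p 0) ^ 2 * (D 1 p + D 2 p + D 3 p))
    + csq p * ((p 3) ^ 2 * (D 1 p * D 2 p) + (p 2) ^ 2 * (D 1 p * D 3 p) + (p 1) ^ 2 * (D 2 p * D 3 p)
        + (p 0) ^ 2 * (D 1 p * D 2 p + D 1 p * D 3 p + D 2 p * D 3 p))
    + csq p ^ 2 * ((p 0) ^ 2 * (D 1 p * D 2 p * D 3 p))

/-- **The «algebraic miracle» to all orders**: `N + p₁²e₂e₃e₄ = p²·Q̃` — the numerator of `A^N_1 − p₁S` is divisible by
`p²` as a holomorphic function (it vanishes on the whole complex cone `p² = 0`), since `e_j ≡ 1 (mod p²)` and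
`p₂² + p₃² + p₄² + p₁² = p²`. [cite: FederbushWilliamson1987PhaseCellII, (5.5), (5.7)–(5.8) p. 1418] -/
theorem Nn_add_eq (p : Momentum) : Nn p + (p 0) ^ 2 * E 1 p * E 2 p * E 3 p = csq p * Qr p := by
  simp only [Nn, E, Qr, csq_eq]
  ring

/-- `∏_{j ≠ 1, i} e_j` for `i ≠ 1` (print's indices), as `e₂e₃e₄/e_i` (Lean: `E 1·E 2·E 3 / E i`; `e_i ≠ 0` on `U`).
[cite: FederbushWilliamson1987PhaseCellII, (5.6)–(5.7) p. 1418] -/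
def Eo (i : Fin 4) (p : Momentum) : ℂ := E 1 p * E 2 p * E 3 p / E i p

/-- **The holomorphic representatives** of the four components of the mode in the gauge `X̃`:
`gRep 0 = Φ·Q̃/(r₀(1+ĝ))`, `gRep i = p_i p₁ Φ (∏_{j≠1,i} e_j) D_i/(r₀(1+ĝ))` (`i ≠ 1`, print's indices).
[cite: FederbushWilliamson1987PhaseCellII, (5.5)–(5.8) p. 1418] -/
def gRep (i : Fin 4) (p : Momentum) : ℂ :=
  if i = 0 then Phi p * Qr p / (r0 p * (1 + ghat p))
  else p i * p 0 * Phi p * Eo i p * D i p / (r0 p * (1 + ghat p))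

/-- (plumbing) `Φ`, `r₀` are holomorphic on `U`. [cite: FederbushWilliamson1987PhaseCellII, §V p. 1418] -/
private theorem differentiableOn_Phi : DifferentiableOn ℂ Phi U := fun p _ =>
  (analyticAt_Phi p).differentiableAt.differentiableWithinAt

/-- (plumbing) `r₀` is holomorphic on `U`. [cite: FederbushWilliamson1987PhaseCellII, §V p. 1418] -/
private theorem differentiableOn_r0 : DifferentiableOn ℂ r0 U := fun p _ =>
  (analyticAt_r0 p).differentiableAt.differentiableWithinAt

/-- (plumbing) coordinate projections are holomorphic. [folklore] -/
private theorem differentiableOn_apply (i : Fin 4) : DifferentiableOn ℂ (fun p : Momentum => p i) U :=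
  (differentiable_apply i).differentiableOn

/-- (plumbing) quotients of holomorphic functions on `ℂ⁴` with non-vanishing denominator. [folklore] -/
private theorem differentiableOn_div' {f g : Momentum → ℂ} (hf : DifferentiableOn ℂ f U)
    (hg : DifferentiableOn ℂ g U) (h : ∀ p ∈ U, g p ≠ 0) : DifferentiableOn ℂ (fun p => f p / g p) U := by
  have e : (fun p => f p / g p) = fun p => f p * (g p)⁻¹ := funext fun p => div_eq_mul_inv _ _
  rw [e]; exact hf.mul (hg.inv h)

/-- `Q̃` is holomorphic on the ball `U = {‖p‖ < ½}`. [cite: FederbushWilliamson1987PhaseCellII, (6.8) p. 1418] -/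
theorem differentiableOn_Qr : DifferentiableOn ℂ Qr U := by
  have hD := differentiableOn_D
  have hc : DifferentiableOn ℂ csq U := differentiable_csq.differentiableOn
  have hsq : ∀ i : Fin 4, DifferentiableOn ℂ (fun p : Momentum => (p i) ^ 2) U := fun i =>
    (differentiableOn_apply i).pow 2
  unfold Qr
  refine ((DifferentiableOn.add (differentiableOn_const 1) ?_).add (hc.mul ?_)).add ((hc.pow 2).mul ?_)
  · exact ((((hsq 3).mul ((hD 1).add (hD 2))).add ((hsq 2).mul ((hD 1).add (hD 3)))).add
      ((hsq 1).mul ((hD 2).add (hD 3)))).add ((hsq 0).mul (((hD 1).add (hD 2)).add (hD 3)))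
  · exact ((((hsq 3).mul ((hD 1).mul (hD 2))).add ((hsq 2).mul ((hD 1).mul (hD 3)))).add
      ((hsq 1).mul ((hD 2).mul (hD 3)))).add
      ((hsq 0).mul ((((hD 1).mul (hD 2)).add ((hD 1).mul (hD 3))).add ((hD 2).mul (hD 3))))
  · exact (hsq 0).mul (((hD 1).mul (hD 2)).mul (hD 3))

/-- `∏_{j≠1,i} e_j` is holomorphic on `U`. [cite: FederbushWilliamson1987PhaseCellII, (6.8) p. 1418] -/
theorem differentiableOn_Eo (i : Fin 4) : DifferentiableOn ℂ (Eo i) U := by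
  unfold Eo
  exact differentiableOn_div' (((differentiableOn_E 1).mul (differentiableOn_E 2)).mul (differentiableOn_E 3))
    (differentiableOn_E i) fun p hp => E_ne_zero hp i

/-- The representatives are holomorphic on `U` (denominators `r₀(1+ĝ) ≠ 0` there). [cite: FederbushWilliamson1987PhaseCellII,
§V–§VI p. 1418] -/
theorem differentiableOn_gRep (i : Fin 4) : DifferentiableOn ℂ (gRep i) U := by
  have hden : DifferentiableOn ℂ (fun p => r0 p * (1 + ghat p)) U :=
    differentiableOn_r0.mul (differentiableOn_ghat.const_add 1)
  have hden0 : ∀ p ∈ U, r0 p * (1 + ghat p) ≠ 0 := fun p hp =>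
    mul_ne_zero (r0_ne_zero hp) (one_add_ghat_ne_zero hp)
  by_cases hi : i = 0
  · have : gRep i = fun p => Phi p * Qr p / (r0 p * (1 + ghat p)) := by
      funext p; simp [gRep, hi]
    rw [this]
    exact differentiableOn_div' (differentiableOn_Phi.mul differentiableOn_Qr) hden hden0
  · have : gRep i = fun p => p i * p 0 * Phi p * Eo i p * D i p / (r0 p * (1 + ghat p)) := by
      funext p; simp [gRep, hi]
    rw [this]
    exact differentiableOn_div' (((((differentiableOn_apply i).mul (differentiableOn_apply 0)).mul
      differentiableOn_Phi).mul (differentiableOn_Eo i)).mul (differentiableOn_D i)) hden hden0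

/-- **The representatives are ANALYTIC on the ball `‖p‖ < ½`.** [cite: FederbushWilliamson1987PhaseCellII, Theorem 3.1
p. 1417, §VI p. 1418] -/
theorem analyticOnNhd_gRep (i : Fin 4) : AnalyticOnNhd ℂ (gRep i) U :=
  Literature.Analysis.Complex.SCV.analyticOnNhd_of_differentiableOn (differentiableOn_gRep i) isOpen_U

/-! ## §3. The identities at the generic points of the ball -/

/-- (1.18) resolved by (5.3): `𝒟 = 16·r₀³·p²(1+ĝ)/((p²)³(p₁p₂p₃p₄)²)` at the generic points of `U`.
[cite: FederbushWilliamson1987PhaseCellII, (1.18) p. 1417, (5.3), (6.11) p. 1418] -/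
theorem scrD_eq {p : Momentum} (hU : p ∈ U) (hp : ∀ i, p i ≠ 0) (hc : csq p ≠ 0) :
    scrD p = 16 * (r0 p ^ 3 * (csq p * (1 + ghat p)) / (csq p ^ 3 * (p 0 * p 1 * p 2 * p 3) ^ 2)) := by
  have hB0 := invSqBracket_eq hU hp hc 0
  have hB1 := invSqBracket_eq hU hp hc 1
  have hB2 := invSqBracket_eq hU hp hc 2
  have hB3 := invSqBracket_eq hU hp hc 3
  have hp0 := hp 0; have hp1 := hp 1; have hp2 := hp 2; have hp3 := hp 3
  rw [scrD_expand, hB0, hB1, hB2, hB3, ← den_eq p]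
  field_simp

/-- `𝒟 ≠ 0` at the generic points of `U`. [cite: FederbushWilliamson1987PhaseCellII, (1.18) p. 1417] -/
theorem scrD_ne_zero {p : Momentum} (hU : p ∈ U) (hp : ∀ i, p i ≠ 0) (hc : csq p ≠ 0) : scrD p ≠ 0 := by
  rw [scrD_eq hU hp hc]
  have hr := r0_ne_zero hU
  have hg := one_add_ghat_ne_zero hU
  have hp0 := hp 0; have hp1 := hp 1; have hp2 := hp 2; have hp3 := hp 3
  exact mul_ne_zero (by norm_num) (div_ne_zero (by positivity) (by positivity))

/-- (2.3): `l₂ = −⟨1/p₃²⟩⟨1/p₄²⟩` (Lean `l 1 = −B₂B₃`). [cite: FederbushWilliamson1987PhaseCellII, (2.3) p. 1417] -/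
theorem l_one (p : Momentum) : l 1 p = -(invSqBracket 2 p * invSqBracket 3 p) := by
  have e : ((Finset.univ : Finset (Fin 4)).erase 0).erase 1 = {2, 3} := by decide
  simp [l, e, Finset.prod_insert, Finset.prod_singleton]

/-- (2.3): `l₃ = −⟨1/p₂²⟩⟨1/p₄²⟩` (Lean `l 2 = −B₁B₃`). [cite: FederbushWilliamson1987PhaseCellII, (2.3) p. 1417] -/
theorem l_two (p : Momentum) : l 2 p = -(invSqBracket 1 p * invSqBracket 3 p) := by
  have e : ((Finset.univ : Finset (Fin 4)).erase 0).erase 2 = {1, 3} := by decide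
  simp [l, e, Finset.prod_insert, Finset.prod_singleton]

/-- (2.3): `l₄ = −⟨1/p₂²⟩⟨1/p₃²⟩` (Lean `l 3 = −B₁B₂`). [cite: FederbushWilliamson1987PhaseCellII, (2.3) p. 1417] -/
theorem l_three (p : Momentum) : l 3 p = -(invSqBracket 1 p * invSqBracket 2 p) := by
  have e : ((Finset.univ : Finset (Fin 4)).erase 0).erase 3 = {1, 2} := by decide
  simp [l, e, Finset.prod_insert, Finset.prod_singleton]

/-- **`X̃` resolved**: at the generic points of `U` with `e^{ip₁} ≠ 1`, `X̃ = Φ·p₁·e₂e₃e₄/(p²·r₀·(1+ĝ))`.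
[cite: FederbushWilliamson1987PhaseCellII, (5.1)–(5.4) p. 1417–1418] -/
theorem Xtilde_eq {p : Momentum} (hU : p ∈ U) (hp : ∀ i, p i ≠ 0) (hc : csq p ≠ 0) (hf : exp (I * p 0) ≠ 1) :
    Xtilde p = Phi p * p 0 * E 1 p * E 2 p * E 3 p / (csq p * r0 p * (1 + ghat p)) := by
  have hB1 := invSqBracket_eq hU hp hc 1
  have hB2 := invSqBracket_eq hU hp hc 2
  have hB3 := invSqBracket_eq hU hp hc 3
  have hr := r0_ne_zero hU
  have hg := one_add_ghat_ne_zero hU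
  have hp0 := hp 0; have hp1 := hp 1; have hp2 := hp 2; have hp3 := hp 3
  unfold Xtilde
  rw [scrD_eq hU hp hc, prefactor_eq hp hf, hB1, hB2, hB3]
  field_simp

/-- **`A′₁` resolved** ((5.5) without the `X`-term): `A′₁ = Φ·N/(p²·r₀·(1+ĝ))`. [cite: FederbushWilliamson1987PhaseCellII,
(2.1)–(2.2) p. 1417, (5.5) p. 1418] -/
theorem Aprime_zero_eq {p : Momentum} (hU : p ∈ U) (hp : ∀ i, p i ≠ 0) (hc : csq p ≠ 0) (hf : exp (I * p 0) ≠ 1) :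
    Aprime 0 p = Phi p * Nn p / (csq p * r0 p * (1 + ghat p)) := by
  have hB1 := invSqBracket_eq hU hp hc 1
  have hB2 := invSqBracket_eq hU hp hc 2
  have hB3 := invSqBracket_eq hU hp hc 3
  have hr := r0_ne_zero hU
  have hg := one_add_ghat_ne_zero hU
  have hp0 := hp 0; have hp1 := hp 1; have hp2 := hp 2; have hp3 := hp 3
  unfold Aprime
  rw [scrD_eq hU hp hc, prefactor_eq hp hf, l_zero, hB1, hB2, hB3]
  unfold Nn
  field_simp

/-- **`A′₂` resolved** ((5.6)-type): `A′₂ = −Φ·p₁p₂·e₃e₄/(p²·r₀·(1+ĝ))` (Lean indices `0,1`; `e₃e₄` = `E 2·E 3`).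
[cite: FederbushWilliamson1987PhaseCellII, (2.1), (2.3) p. 1417, (5.6) p. 1418] -/
theorem Aprime_one_eq {p : Momentum} (hU : p ∈ U) (hp : ∀ i, p i ≠ 0) (hc : csq p ≠ 0) (hf : exp (I * p 0) ≠ 1) :
    Aprime 1 p = -(Phi p * p 0 * p 1 * E 2 p * E 3 p) / (csq p * r0 p * (1 + ghat p)) := by
  have hB2 := invSqBracket_eq hU hp hc 2
  have hB3 := invSqBracket_eq hU hp hc 3
  have hr := r0_ne_zero hU
  have hg := one_add_ghat_ne_zero hU
  have hp0 := hp 0; have hp1 := hp 1; have hp2 := hp 2; have hp3 := hp 3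
  unfold Aprime
  rw [scrD_eq hU hp hc, prefactor_eq hp hf, l_one, hB2, hB3]
  field_simp

/-- `A′₃ = −Φ·p₁p₃·e₂e₄/(p²·r₀·(1+ĝ))` (Lean indices `0,2`). [cite: FederbushWilliamson1987PhaseCellII, (2.1), (2.3)
p. 1417, (5.6) p. 1418] -/
theorem Aprime_two_eq {p : Momentum} (hU : p ∈ U) (hp : ∀ i, p i ≠ 0) (hc : csq p ≠ 0) (hf : exp (I * p 0) ≠ 1) :
    Aprime 2 p = -(Phi p * p 0 * p 2 * E 1 p * E 3 p) / (csq p * r0 p * (1 + ghat p)) := by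
  have hB1 := invSqBracket_eq hU hp hc 1
  have hB3 := invSqBracket_eq hU hp hc 3
  have hr := r0_ne_zero hU
  have hg := one_add_ghat_ne_zero hU
  have hp0 := hp 0; have hp1 := hp 1; have hp2 := hp 2; have hp3 := hp 3
  unfold Aprime
  rw [scrD_eq hU hp hc, prefactor_eq hp hf, l_two, hB1, hB3]
  field_simp

/-- `A′₄ = −Φ·p₁p₄·e₂e₃/(p²·r₀·(1+ĝ))` (Lean indices `0,3`). [cite: FederbushWilliamson1987PhaseCellII, (2.1), (2.3)
p. 1417, (5.6) p. 1418] -/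
theorem Aprime_three_eq {p : Momentum} (hU : p ∈ U) (hp : ∀ i, p i ≠ 0) (hc : csq p ≠ 0) (hf : exp (I * p 0) ≠ 1) :
    Aprime 3 p = -(Phi p * p 0 * p 3 * E 1 p * E 2 p) / (csq p * r0 p * (1 + ghat p)) := by
  have hB1 := invSqBracket_eq hU hp hc 1
  have hB2 := invSqBracket_eq hU hp hc 2
  have hr := r0_ne_zero hU
  have hg := one_add_ghat_ne_zero hU
  have hp0 := hp 0; have hp1 := hp 1; have hp2 := hp 2; have hp3 := hp 3
  unfold Aprime
  rw [scrD_eq hU hp hc, prefactor_eq hp hf, l_three, hB1, hB2]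
  field_simp

/-- `i = 1` (Lean `0`): `A′₁ + p₁X̃ = Φ·Q̃/(r₀(1+ĝ))` — (5.5)+(5.8) with the `p²`-division carried out exactly
(`Nn_add_eq`). [cite: FederbushWilliamson1987PhaseCellII, (5.5)–(5.8) p. 1418] -/
theorem ANtilde_zero_eq {p : Momentum} (hU : p ∈ U) (hp : ∀ i, p i ≠ 0) (hc : csq p ≠ 0) (hf : exp (I * p 0) ≠ 1) :
    ANtilde 0 p = gRep 0 p := by
  have hr := r0_ne_zero hU
  have hg := one_add_ghat_ne_zero hU
  have hp0 := hp 0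
  unfold ANtilde gRep
  rw [if_pos rfl, Aprime_zero_eq hU hp hc hf, Xtilde_eq hU hp hc hf]
  have hQ : Qr p = (Nn p + (p 0) ^ 2 * E 1 p * E 2 p * E 3 p) / csq p := by
    rw [Nn_add_eq, mul_div_cancel_left₀ _ hc]
  rw [hQ]
  field_simp

/-- `i = 2` (Lean `1`): `A′₂ + p₂X̃ = p₂p₁Φ·e₃e₄·D₂/(r₀(1+ĝ))` — the bracket `−e₃e₄ + e₂e₃e₄ = e₃e₄(e₂ − 1) = e₃e₄·p²D₂`
cancels the pole. [cite: FederbushWilliamson1987PhaseCellII, (5.6)–(5.7) p. 1418] -/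
theorem ANtilde_one_eq {p : Momentum} (hU : p ∈ U) (hp : ∀ i, p i ≠ 0) (hc : csq p ≠ 0) (hf : exp (I * p 0) ≠ 1) :
    ANtilde 1 p = gRep 1 p := by
  have hr := r0_ne_zero hU
  have hg := one_add_ghat_ne_zero hU
  have hE1 := E_ne_zero hU 1
  have hp0 := hp 0; have hp1 := hp 1
  unfold ANtilde gRep Eo
  rw [if_neg (by decide), Aprime_one_eq hU hp hc hf, Xtilde_eq hU hp hc hf]
  unfold E
  unfold E at hE1
  field_simp
  ring

/-- `i = 3` (Lean `2`): `A′₃ + p₃X̃ = p₃p₁Φ·e₂e₄·D₃/(r₀(1+ĝ))`. [cite: FederbushWilliamson1987PhaseCellII, (5.6)–(5.7) p. 1418] -/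
theorem ANtilde_two_eq {p : Momentum} (hU : p ∈ U) (hp : ∀ i, p i ≠ 0) (hc : csq p ≠ 0) (hf : exp (I * p 0) ≠ 1) :
    ANtilde 2 p = gRep 2 p := by
  have hr := r0_ne_zero hU
  have hg := one_add_ghat_ne_zero hU
  have hE2 := E_ne_zero hU 2
  have hp0 := hp 0; have hp2 := hp 2
  unfold ANtilde gRep Eo
  rw [if_neg (by decide), Aprime_two_eq hU hp hc hf, Xtilde_eq hU hp hc hf]
  unfold E
  unfold E at hE2
  field_simp
  ring

/-- `i = 4` (Lean `3`): `A′₄ + p₄X̃ = p₄p₁Φ·e₂e₃·D₄/(r₀(1+ĝ))`. [cite: FederbushWilliamson1987PhaseCellII, (5.6)–(5.7) p. 1418] -/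
theorem ANtilde_three_eq {p : Momentum} (hU : p ∈ U) (hp : ∀ i, p i ≠ 0) (hc : csq p ≠ 0) (hf : exp (I * p 0) ≠ 1) :
    ANtilde 3 p = gRep 3 p := by
  have hr := r0_ne_zero hU
  have hg := one_add_ghat_ne_zero hU
  have hE3 := E_ne_zero hU 3
  have hp0 := hp 0; have hp3 := hp 3
  unfold ANtilde gRep Eo
  rw [if_neg (by decide), Aprime_three_eq hU hp hc hf, Xtilde_eq hU hp hc hf]
  unfold E
  unfold E at hE3
  field_simp
  ring

/-- **THE IDENTITIES**: at every generic point of the ball (`p ∈ U`, all `p_j ≠ 0`, `p² ≠ 0`, `e^{ip₁} ≠ 1`) and for EVERY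
component `i`, the mode in the gauge `X̃` equals its holomorphic representative: `A′_i + p_iX̃ = gRep i`.
[cite: FederbushWilliamson1987PhaseCellII, (5.3)–(5.8) p. 1418] -/
theorem ANtilde_eq_gRep {p : Momentum} (hU : p ∈ U) (hp : ∀ i, p i ≠ 0) (hc : csq p ≠ 0) (hf : exp (I * p 0) ≠ 1)
    (i : Fin 4) : ANtilde i p = gRep i p := by
  fin_cases i
  exacts [ANtilde_zero_eq hU hp hc hf, ANtilde_one_eq hU hp hc hf, ANtilde_two_eq hU hp hc hf,
    ANtilde_three_eq hU hp hc hf]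

/-- **The real generic momenta of the ball are generic points**: for `p ∈ U ∩ realGeneric` all `p_j ≠ 0`, `p² ≠ 0`
(`p² = Σ_j p_j² > 0`, `p` real) and `e^{ip₁} ≠ 1` (`0 < |p₁| < ½ < 2π`). [cite: FederbushWilliamson1987PhaseCellII, §I–§II
p. 1416–1417] -/
theorem realGeneric_conds {p : Momentum} (hU : p ∈ U) (hr : p ∈ realGeneric) :
    (∀ i, p i ≠ 0) ∧ csq p ≠ 0 ∧ exp (I * p 0) ≠ 1 := by
  have hne : ∀ i, p i ≠ 0 := fun i => (hr i).2.1
  have hre : ∀ j, p j = (((p j).re : ℝ) : ℂ) := fun j =>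
    Complex.ext (by simp) (by simp [(hr j).1])
  refine ⟨hne, ?_, ?_⟩
  · have hp' : p = fun j => (((p j).re : ℝ) : ℂ) := funext hre
    have hc : csq p = ((∑ j, (p j).re ^ 2 : ℝ) : ℂ) := by
      conv_lhs => rw [hp']
      exact csq_ofReal _
    rw [hc]
    have hre0 : (p 0).re ≠ 0 := by
      intro h
      apply hne 0
      rw [hre 0, h]
      simp
    have hpos : 0 < ∑ j, (p j).re ^ 2 :=
      lt_of_lt_of_le (by positivity : 0 < (p 0).re ^ 2)
        (Finset.single_le_sum (f := fun j => (p j).re ^ 2) (fun j _ => sq_nonneg _) (Finset.mem_univ 0))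
    exact_mod_cast hpos.ne'
  · intro h1
    have hn : ‖p 0‖ < 1 := (norm_apply_lt_of_mem_U hU 0).trans (by norm_num)
    have := phiP_ne_zero hn
    rw [phiP_of_ne (hne 0), h1, sub_self, zero_div] at this
    exact this rfl

/-- Hence at every real generic momentum of the ball, `A′_i + p_iX̃ = gRep i`. [cite: FederbushWilliamson1987PhaseCellII,
Theorem 3.1 p. 1417, §V p. 1418] -/
theorem ANtilde_eq_gRep_of_realGeneric {p : Momentum} (hU : p ∈ U) (hr : p ∈ realGeneric) (i : Fin 4) :
    ANtilde i p = gRep i p := by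
  obtain ⟨hp, hc, hf⟩ := realGeneric_conds hU hr
  exact ANtilde_eq_gRep hU hp hc hf i

/-! ## §4. Theorem 3.1 at `p = 0` in the gauge `X̃`, and the gauge artefact -/

/-- **THEOREM 3.1 AT `p = 0` IN THE GAUGE `X̃`.**  For every component `i` there is a function holomorphic (analytic) on the
ball `‖p‖ < ½` — a neighbourhood of `p = 0` which lies in `𝒟_L(ε₀)` for `ε₀ ≥ ½` and meets every `𝒟_L(ε₀)` in a
neighbourhood of `0` — that agrees with the mode `A′_i + p_iX̃` at all real generic momenta of the ball.  Contrast: for the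
printed gauge functions (2.5) this fails for `i = 1` and every `s` (`ModeAnalyticityThm31Refutation.no_holomorphic_extension`).
[cite: FederbushWilliamson1987PhaseCellII, Theorem 3.1 (3.2) p. 1417, (2.4)–(2.5) p. 1417, §V–§VI p. 1418] -/
theorem theorem31_at_zero_in_gauge_Xtilde (i : Fin 4) :
    ∃ g : Momentum → ℂ, AnalyticOnNhd ℂ g (ball 0 (1 / 2)) ∧
      ∀ p ∈ realGeneric, p ∈ ball (0 : Momentum) (1 / 2) → g p = ANtilde i p :=
  ⟨gRep i, analyticOnNhd_gRep i, fun _ hr hU => (ANtilde_eq_gRep_of_realGeneric hU hr i).symm⟩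

/-- The same on every smaller ball `‖p‖ < ρ ≤ ½` inside `𝒟_L(ε₀)` (`ρ ≤ ε₀`): the form directly comparable with the
refutation `no_holomorphic_extension` (which denies exactly this for `A^N_1` in every printed gauge).
[cite: FederbushWilliamson1987PhaseCellII, Theorem 3.1 (3.2) p. 1417] -/
theorem holomorphic_extension_in_gauge_Xtilde (i : Fin 4) {ρ ε₀ : ℝ} (hρ : 0 < ρ) (hρ2 : ρ ≤ 1 / 2) (hρε : ρ ≤ ε₀) :
    ball (0 : Momentum) ρ ⊆ DL ε₀ ∧ ∃ g : Momentum → ℂ, DifferentiableOn ℂ g (ball 0 ρ) ∧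
      ∀ p ∈ realGeneric, p ∈ ball (0 : Momentum) ρ → g p = ANtilde i p :=
  ⟨ball_subset_DL hρ hρ2 hρε, gRep i, (differentiableOn_gRep i).mono (ball_subset_U hρ2),
    fun _ hr hp => (ANtilde_eq_gRep_of_realGeneric (ball_subset_U hρ2 hp) hr i).symm⟩

/-- **THE GAUGE ARTEFACT.**  On the ball `‖p‖ < ½`: (a) in every PRINTED gauge (2.5) (every `s`) the component `A^N_1` admits
NO holomorphic function agreeing with it at the real generic momenta (p250244); (b) in the gauge `X̃` EVERY component does.
The light-cone pole of Theorem 3.1's refutation lies in the gauge term `p_i(X − X̃)`. [cite: FederbushWilliamson1987PhaseCellII,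
Theorem 3.1 p. 1417, (2.4)–(2.5) p. 1417, (5.5)–(5.8) p. 1418] -/
theorem gauge_artefact (s : ℕ) :
    (¬ ∃ g : Momentum → ℂ, DifferentiableOn ℂ g (ball 0 (1 / 2)) ∧
        ∀ p ∈ realGeneric, p ∈ ball (0 : Momentum) (1 / 2) → g p = AN s 0 p) ∧
    (∀ i : Fin 4, ∃ g : Momentum → ℂ, AnalyticOnNhd ℂ g (ball 0 (1 / 2)) ∧
        ∀ p ∈ realGeneric, p ∈ ball (0 : Momentum) (1 / 2) → g p = ANtilde i p) := by
  refine ⟨?_, theorem31_at_zero_in_gauge_Xtilde⟩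
  rintro ⟨g, hg, hagree⟩
  exact no_holomorphic_extension s (by norm_num) le_rfl hg hagree

/-! ## §5. The gauge-invariant content of the PRINTED mode is holomorphic at `p = 0` -/

/-- The momentum-space field strength of the printed mode (2.4): `F_{ij}(p) := p_iA^N_j(p) − p_jA^N_i(p)`.
[cite: FederbushWilliamson1987PhaseCellII, (2.4) p. 1417] -/
def fieldStrength (s : ℕ) (i j : Fin 4) (p : Momentum) : ℂ := p i * AN s j p - p j * AN s i p

/-- The field strength does not see the gauge function: `p_iA^N_j − p_jA^N_i = p_iA′_j − p_jA′_i` for every `X` of (2.5)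
(and likewise for `X̃`, `fieldStrength_eq_tilde`). [cite: FederbushWilliamson1987PhaseCellII, (2.4) p. 1417] -/
theorem fieldStrength_eq_prime (s : ℕ) (i j : Fin 4) (p : Momentum) :
    fieldStrength s i j p = p i * Aprime j p - p j * Aprime i p := by
  unfold fieldStrength AN
  ring

/-- … and equals the field strength of the mode in the gauge `X̃`. [cite: FederbushWilliamson1987PhaseCellII, (2.4) p. 1417] -/
theorem fieldStrength_eq_tilde (s : ℕ) (i j : Fin 4) (p : Momentum) :
    fieldStrength s i j p = p i * ANtilde j p - p j * ANtilde i p := by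
  unfold fieldStrength AN ANtilde
  ring

/-- **The gauge-invariant content of the printed mode is holomorphic at `p = 0`.**  For every `s` and all `i, j` there is a
function analytic on the ball `‖p‖ < ½` agreeing with `p_iA^N_j − p_jA^N_i` at the real generic momenta of the ball
(namely `p_i·gRep j − p_j·gRep i`): the light-cone pole of `A^N` (p250244) is pure gauge.
[cite: FederbushWilliamson1987PhaseCellII, Theorem 3.1 p. 1417, (2.4) p. 1417, (5.5)–(5.8) p. 1418] -/
theorem fieldStrength_analytic (s : ℕ) (i j : Fin 4) :
    ∃ F : Momentum → ℂ, AnalyticOnNhd ℂ F (ball 0 (1 / 2)) ∧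
      ∀ p ∈ realGeneric, p ∈ ball (0 : Momentum) (1 / 2) → F p = fieldStrength s i j p := by
  refine ⟨fun p => p i * gRep j p - p j * gRep i p, ?_, fun p hr hU => ?_⟩
  · have h : DifferentiableOn ℂ (fun p : Momentum => p i * gRep j p - p j * gRep i p) U :=
      ((differentiableOn_apply i).mul (differentiableOn_gRep j)).sub
        ((differentiableOn_apply j).mul (differentiableOn_gRep i))
    exact Literature.Analysis.Complex.SCV.analyticOnNhd_of_differentiableOn h isOpen_U
  · rw [fieldStrength_eq_tilde, ANtilde_eq_gRep_of_realGeneric hU hr i, ANtilde_eq_gRep_of_realGeneric hU hr j]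

end ModeAnalyticityGaugeRepair

end

end Literature.MathematicalPhysics.QuantumFieldTheory.Federbush1986
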